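import Literature.NumberTheory.GaloisRepresentations.StableLattice
import Mathlib.RingTheory.LocalRing.ResidueField.Basic
import Mathlib.LinearAlgebra.Matrix.Charpoly.Basic
import Mathlib.Topology.Algebra.Ring.Basic
import HarnessLib

/-!
# Reduction of a compact group of matrices modulo the maximal ideal

Continuation of `Literature.NumberTheory.GaloisRepresentations.StableLattice` (Deligne–Serre
1974, 6.12: "Par réduction mod `λ` on déduit de `ρ_λ` une représentation
`ρ̃_λ : G → GL₂(k_λ)`"). Let `F` be a topological field, `O ⊆ F` an open valuation subring which
is a principal ideal domain and whose maximal ideal `𝔪` is open in `F`, with residue field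
`κ = O/𝔪`; let `G` be a compact topological group and `ρ : G →ₜ* GL_n(F)` continuous. Then,
after conjugating `ρ` into `GL_n(O)` (`exists_conj_mem_range_generalLinearGroup_map`), one
obtains an *integral model* `ρ₀ : G →* GL_n(O)` of `ρ` (`P⁻¹ ρ P = ρ₀` in `GL_n(F)`), and its
**reduction** `ρ̄ = ρ₀ mod 𝔪 : G →* GL_n(κ)` has **open kernel** (so it is continuous for the
discrete topology on `κ`, and has finite image), and the characteristic polynomial of `ρ̄(g)` is
the reduction of that of `ρ₀(g)`, which maps to that of `ρ(g)` in `F[X]`. Everything is PROVED.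

* `Literature.NumberTheory.GaloisRepresentations.exists_integralModel` — `P` and
  `ρ₀ : G →* GL_n(O)` with `map ρ₀ = P⁻¹ ρ P`.
* `Literature.NumberTheory.GaloisRepresentations.isOpen_ker_residualRep` — the kernel of
  `ρ₀ mod 𝔪` is open.
* `Literature.NumberTheory.GaloisRepresentations.charpoly_residualRep`,
  `charpoly_integralModel` — compatibility of characteristic polynomials.

## References

* P. Deligne, J.-P. Serre, *Formes modulaires de poids 1*, Ann. Sci. ÉNS (4) 7 (1974), 6.12.
* J.-P. Serre, *Abelian ℓ-adic representations and elliptic curves* (1968), Ch. I, §1.1.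
-/

noncomputable section

open scoped MatrixGroups

open Matrix IsLocalRing

namespace Literature.NumberTheory.GaloisRepresentations

universe u

variable {F : Type u} [Field F] {O : ValuationSubring F} {n : ℕ}
variable {G : Type*} [Group G]

/-! ### Integral models -/

/-- A homomorphism `G → GL_n(F)` with values in (the image of) `GL_n(O)` lifts uniquely to a
homomorphism `G → GL_n(O)` (`GL_n(O) → GL_n(F)` is injective). [folklore] -/
theorem exists_monoidHom_map_eq (φ : G →* GL (Fin n) F)
    (hφ : ∀ g, φ g ∈ (Matrix.GeneralLinearGroup.map (n := Fin n) O.subtype).range) :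
    ∃ φ₀ : G →* GL (Fin n) O, ∀ g, Matrix.GeneralLinearGroup.map O.subtype (φ₀ g) = φ g := by
  have hinj : Function.Injective (Matrix.GeneralLinearGroup.map (n := Fin n) O.subtype) := by
    intro A B h
    refine Units.ext (Matrix.ext fun i j ↦ O.subtype_injective ?_)
    have := congrArg (fun M : GL (Fin n) F ↦ (M : Matrix (Fin n) (Fin n) F) i j) h
    simpa [Matrix.GeneralLinearGroup.map] using this
  let e : GL (Fin n) O ≃* (Matrix.GeneralLinearGroup.map (n := Fin n) O.subtype).range :=
    MonoidHom.ofInjective hinj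
  let φ' : G →* (Matrix.GeneralLinearGroup.map (n := Fin n) O.subtype).range :=
    φ.codRestrict _ hφ
  refine ⟨e.symm.toMonoidHom.comp φ', fun g ↦ ?_⟩
  have h1 : (Matrix.GeneralLinearGroup.map O.subtype (e.symm (φ' g)) : GL (Fin n) F) =
      ((e (e.symm (φ' g)) : (Matrix.GeneralLinearGroup.map (n := Fin n) O.subtype).range) :
        GL (Fin n) F) := rfl
  rw [MonoidHom.comp_apply, MulEquiv.coe_toMonoidHom, h1, MulEquiv.apply_symm_apply]
  rfl

variable [TopologicalSpace F] [TopologicalSpace G] [IsTopologicalGroup G] [CompactSpace G]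

/-- **Integral models** (Serre, *Abelian ℓ-adic representations*, I.1.1; Deligne–Serre 1974,
6.12). For `O ⊆ F` an open valuation subring which is a principal ideal domain, `G` compact and
`ρ : G →ₜ* GL_n(F)` continuous, there are `P ∈ GL_n(F)` and a homomorphism `ρ₀ : G → GL_n(O)`
with `ρ₀(g) = P⁻¹ ρ(g) P` in `GL_n(F)` for all `g`. [cite: SerreAbelianLadic1968, Ch. I §1.1, Remark 1] -/
theorem exists_integralModel [IsPrincipalIdealRing O] (hO : IsOpen (O : Set F))
    (ρ : G →ₜ* GL (Fin n) F) :
    ∃ (P : GL (Fin n) F) (ρ₀ : G →* GL (Fin n) O),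
      ∀ g, Matrix.GeneralLinearGroup.map O.subtype (ρ₀ g) = P⁻¹ * ρ g * P := by
  obtain ⟨P, hP⟩ := exists_conj_mem_range_generalLinearGroup_map hO ρ
  let φ : G →* GL (Fin n) F := (MulAut.conj P⁻¹).toMonoidHom.comp ρ.toMonoidHom
  have hφ : ∀ g, φ g = P⁻¹ * ρ g * P := fun g ↦ by
    simp [φ]
  obtain ⟨ρ₀, hρ₀⟩ := exists_monoidHom_map_eq φ fun g ↦ (hφ g) ▸ hP g
  exact ⟨P, ρ₀, fun g ↦ (hρ₀ g).trans (hφ g)⟩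

omit [TopologicalSpace F] [TopologicalSpace G] [IsTopologicalGroup G] [CompactSpace G] in
/-- The characteristic polynomial of an integral model maps to that of `ρ`:
`charpoly(ρ₀ g) ↦ charpoly(P⁻¹ ρ(g) P) = charpoly(ρ g)`. [folklore] -/
theorem charpoly_integralModel {ρ : G →* GL (Fin n) F} {P : GL (Fin n) F}
    {ρ₀ : G →* GL (Fin n) O}
    (h : ∀ g, Matrix.GeneralLinearGroup.map O.subtype (ρ₀ g) = P⁻¹ * ρ g * P) (g : G) :
    ((ρ₀ g : GL (Fin n) O) : Matrix (Fin n) (Fin n) O).charpoly.map O.subtype =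
      ((ρ g : GL (Fin n) F) : Matrix (Fin n) (Fin n) F).charpoly := by
  rw [← Matrix.charpoly_map]
  have h1 : ((ρ₀ g : GL (Fin n) O) : Matrix (Fin n) (Fin n) O).map O.subtype =
      ((Matrix.GeneralLinearGroup.map O.subtype (ρ₀ g) : GL (Fin n) F) :
        Matrix (Fin n) (Fin n) F) := rfl
  rw [h1, h, Units.val_mul, Units.val_mul, Matrix.coe_units_inv]
  exact Matrix.charpoly_units_conj' P _

/-! ### Reduction modulo `𝔪` -/

omit [TopologicalSpace F] [TopologicalSpace G] [IsTopologicalGroup G] [CompactSpace G] in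
/-- The characteristic polynomial of the reduction `ρ₀(g) mod 𝔪` is the reduction of the
characteristic polynomial of `ρ₀(g)`. [folklore] -/
theorem charpoly_residualRep (ρ₀ : G →* GL (Fin n) O) (g : G) :
    (((Matrix.GeneralLinearGroup.map (residue O)).comp ρ₀ g : GL (Fin n) (ResidueField O)) :
        Matrix (Fin n) (Fin n) (ResidueField O)).charpoly =
      ((ρ₀ g : GL (Fin n) O) : Matrix (Fin n) (Fin n) O).charpoly.map (residue O) := by
  rw [← Matrix.charpoly_map]
  rfl

variable [IsTopologicalRing F]

omit [IsTopologicalGroup G] [CompactSpace G] in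
/-- **The reduction of an integral model has open kernel** (Deligne–Serre 1974, 6.12). With
`ρ₀(g) = P⁻¹ ρ(g) P ∈ GL_n(O)` as in `exists_integralModel` and the maximal ideal `𝔪` of `O`
open in `F`, the kernel of `ρ̄ = ρ₀ mod 𝔪 : G → GL_n(O/𝔪)` is open in `G`; in particular `ρ̄` is
continuous for the discrete topology on `O/𝔪` and, `G` being compact, has finite image.
[cite: DeligneSerreASENS1974, 6.12] -/
theorem isOpen_ker_residualRep
    (hm : IsOpen {x : F | ∃ h : x ∈ O, (⟨x, h⟩ : O) ∈ maximalIdeal O})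
    {ρ : G →ₜ* GL (Fin n) F} {P : GL (Fin n) F} {ρ₀ : G →* GL (Fin n) O}
    (h : ∀ g, Matrix.GeneralLinearGroup.map O.subtype (ρ₀ g) = P⁻¹ * ρ g * P) :
    IsOpen (((Matrix.GeneralLinearGroup.map (residue O)).comp ρ₀).ker : Set G) := by
  -- the entries of `ρ₀ g - 1`
  let y : G → Fin n → Fin n → O := fun g i j ↦
    ((ρ₀ g : GL (Fin n) O) : Matrix (Fin n) (Fin n) O) i j - (1 : Matrix (Fin n) (Fin n) O) i j
  -- the kernel is `{g | ∀ i j, y g i j ∈ 𝔪}`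
  have hmap : ∀ (g : G) (i j : Fin n),
      ((Matrix.GeneralLinearGroup.map (residue O) (ρ₀ g) : GL (Fin n) (ResidueField O)) :
        Matrix (Fin n) (Fin n) (ResidueField O)) i j =
          residue O (((ρ₀ g : GL (Fin n) O) : Matrix (Fin n) (Fin n) O) i j) := fun _ _ _ ↦ rfl
  have hone : ∀ i j : Fin n, residue O ((1 : Matrix (Fin n) (Fin n) O) i j) =
      (1 : Matrix (Fin n) (Fin n) (ResidueField O)) i j := fun i j ↦ by
    by_cases hij : i = j
    · subst hij; simp
    · simp [Matrix.one_apply_ne hij]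
  have hker : (((Matrix.GeneralLinearGroup.map (residue O)).comp ρ₀).ker : Set G) =
      ⋂ i, ⋂ j, {g | y g i j ∈ maximalIdeal O} := by
    ext g
    simp only [SetLike.mem_coe, MonoidHom.mem_ker, MonoidHom.comp_apply, Set.mem_iInter,
      Set.mem_setOf_eq]
    constructor
    · intro hg i j
      have hij := congrArg (fun M : GL (Fin n) (ResidueField O) ↦
        (M : Matrix (Fin n) (Fin n) (ResidueField O)) i j) hg
      rw [hmap, Units.val_one] at hij
      rw [← residue_eq_zero_iff]
      change residue O (_ - _) = 0
      rw [map_sub, hij, hone, sub_self]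
    · intro hg
      refine Units.ext (Matrix.ext fun i j ↦ ?_)
      have hmax := hg i j
      rw [← residue_eq_zero_iff] at hmax
      change residue O (_ - _) = 0 at hmax
      rw [map_sub, sub_eq_zero] at hmax
      rw [hmap, Units.val_one, hmax, hone]
  rw [hker]
  refine isOpen_iInter_of_finite fun i ↦ isOpen_iInter_of_finite fun j ↦ ?_
  -- `y g i j ∈ 𝔪 ↔ (P⁻¹ ρ g P - 1)ᵢⱼ ∈ 𝔪` (in `F`)
  have hset : {g | y g i j ∈ maximalIdeal O} =
      (fun g : G ↦ ((P⁻¹ * ρ g * P : GL (Fin n) F) : Matrix (Fin n) (Fin n) F) i j -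
        (1 : Matrix (Fin n) (Fin n) F) i j) ⁻¹'
          {x : F | ∃ h : x ∈ O, (⟨x, h⟩ : O) ∈ maximalIdeal O} := by
    ext g
    have hval : ((P⁻¹ * ρ g * P : GL (Fin n) F) : Matrix (Fin n) (Fin n) F) i j -
        (1 : Matrix (Fin n) (Fin n) F) i j = (y g i j : F) := by
      rw [← h g]
      by_cases hij' : i = j
      · subst hij'
        simp [y, Matrix.GeneralLinearGroup.map]
      · simp [y, Matrix.GeneralLinearGroup.map, Matrix.one_apply_ne hij']
    simp only [Set.mem_setOf_eq, Set.mem_preimage, hval, Subtype.coe_eta, SetLike.coe_mem,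
      exists_true_left]
  rw [hset]
  refine hm.preimage ?_
  have hc : Continuous fun g : G ↦ ((P⁻¹ * ρ g * P : GL (Fin n) F) : Matrix (Fin n) (Fin n) F) :=
    Units.continuous_val.comp ((continuous_const.mul ρ.continuous_toFun).mul continuous_const)
  exact (hc.matrix_elem i j).sub continuous_const

end Literature.NumberTheory.GaloisRepresentations
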